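import Summits.BirchSwinnertonDyer.BirchSwinnertonDyer.Theorems.GenusKolyvaginAtTwoGenusDeepSupplyAtTwoNegDiscNarrowKFourCellShaTwoRank
import Summits.BirchSwinnertonDyer.BirchSwinnertonDyer.Theorems.GenusKolyvaginAtTwoGenusPrimitiveSupplyAtTwoDescentSignIffSha
import Summits.BirchSwinnertonDyer.BirchSwinnertonDyer.Theorems.GenusKolyvaginAtTwoGenusPrimitiveSupplyAtTwoArchimedeanRelaxedSwitch
import Summits.BirchSwinnertonDyer.BirchSwinnertonDyer.Theorems.GenusKolyvaginAtTwoGenusPrimitiveSupplyAtTwoPosDiscShallowReductionBitFrameEmpty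
import Summits.BirchSwinnertonDyer.BirchSwinnertonDyer.Theorems.GenusKolyvaginAtTwoGenusPrimitiveSupplyAtTwoPosDiscShallowArchimedeanBit
import Summits.BirchSwinnertonDyer.BirchSwinnertonDyer.Theorems.GenusKolyvaginAtTwoGenusPrimitiveSupplyAtTwoPrimeHeegnerTwinPosDisc
import Literature.NumberTheory.EllipticCurves.BSDSelmerCMPConverseKLevelProofs
import Literature.NumberTheory.EllipticCurves.HeegnerTraceRelationSplitProofs
import Literature.NumberTheory.EllipticCurves.HeegnerHypothesisKroneckerProofs
import HarnessLib

/-!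
# Route `GenusKolyvaginAtTwo`, crux 25504 (Δ>0 supply), K₄⁺ CELL: `d_K` IS DESCENT-ADMISSIBLE, `#Sel₂(E_K)^{Gal} = 4`,
# `#Ш(E_K/K)[2] = 4`, `#Sel₂(E_K/K) = 8` — the Δ>0 twin of the LEAD's K₄ file

Seat `bsd-line-gk2-p5` g34 (cell `bsd-f1-sign2`, WIDTH-5 attach), `--supports stmt-BirchSwinnertonDyer-25504 --as helper`; answers the LEAD's word
«the Δ>0 twin K₄⁺ is yours — same count with the ArchBit invariant part: S^{∞} = Sel₂(E) on the real-non-strict cell» (gk2-p1 g22, 07:53Z).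
THEOREMS ONLY (no definition, no named fact, no `sorry`).  **BSD is NOT proved by this file and no item is closed by it.**

The K₄⁺ clause of `GenusPrimitiveSupplyAtTwoPosDiscShallow` is `#Sel₂(E) = 4 ∧ ∃ c ∈ Sel₂(E), loc_∞ c ≠ 0`.  On its frame (`E/ℚ` globally minimal,
`Δ_E > 0`, `ρ̄_{E,2}` onto, `C(E)` odd; `K` imaginary quadratic with odd `d_K`, Heegner for `N_E`, `2` split; an elliptic model `Wd` of `E^{(d_K)}`
with `ord₂ C(Wd) = 0`, i.e. every prime of `d_K` SILENT):

* §1 **`descAdmissible_discr_of_allSilentTwin`** — `d_K` is DESCENT-ADMISSIBLE for `E` (`F1Sign2.DescAdmissible E d_K`: `d_K < 0` squarefree,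
  `≡ 1 (mod 8)` as `2` splits, every `q ∣ d_K` good with `a_q` odd — the factor `#roots_q + 1` of the Tamagawa identity
  `∏ (#roots_q + 1) = 2^{ord₂ C(Wd)} = 1` is `1` — and `(d_K/ℓ) = 1` at the odd bad `ℓ` by Heegner).  This puts the WHOLE all-silent crux frame
  (both Selmer cells) inside the `F1Sign2` descent-admissible dictionary (Kramer's invariant part, AN-10K, the twist laws).
* §2 `natCard_fixedSelmer_eq_natCard_selmerGroupRelaxedAtInfinityAtTwo` — `#Sel₂(E_K/K)^{σ₀} = #Sel₂^{rel ∞}(E)` (Kramer's invariant part in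
  g17's descent-admissible form `GenusKolyArch.mem_selmerGroup_and_conjAct_eq_iff_exists_mem_relaxed`, `res_K` injective as `E(K)[2] = 0`).
* §3 **`natCard_shaTorsionBy_two_baseChange_eq_four_of_kFourPos`** — on the K₄⁺ cell `Sel₂^{rel ∞}(E) = Sel₂(E)` (a class non-trivial at `∞`:
  `GenusKolyArch.selmerGroupRelaxedAtInfinityAtTwo_eq_selmerGroup_of_exists_localization_ne_zero`), so the invariants have order `4`; the LEAD's
  `𝔽₂[G]`-count (`KFourCell.natCard_selmerGroup_baseChange_eq_mul`), the descent count over `K` with `rank E(K) = 1`, `E(K)[2] = 0`, and the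
  Cassels–Tate square give **`#Ш(E_K/K)[2] = 4`, `#Sel₂(E_K/K) = 8`** — the `2`-rank of `Ш(E/K)` is EXACTLY `2` on the K₄⁺ cell, as on K₄.
  UNCONDITIONAL (no `hPT`/`hEP`: the real-place switch is print-free in the tree); companion `…PosDiscShallowKFourTwinSelmer` gives `#Sel₂(Wd) = 2`.

READING (as for K₄): with `Ш(E/K)[2^∞]` of `2`-rank `2`, Kolyvagin–McCallum's structure theorem reads `M₁ = M_∞` — the deep witness of `C⁺‴`,
if any, is a SINGLE-deep-prime statement; BSD predicts `#Ш(E/K)[2^∞] = 4^{M₀}`.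

References: [Kramer1981] Thm. 1, Prop. 3, Prop. 6; [MazurRubin2010] Lemma 2.2, Lemma 3.2; [SilvermanAEC2009] Thm. X.4.2; [Cassels1962ArithmeticIV];
[Cox2013] Prop. 5.16; [Darmon2004] §3.9.
-/

set_option linter.dupNamespace false -- `Summit.<P>.<Sub>` repeats `BirchSwinnertonDyer` (D-0017)
set_option autoImplicit false

noncomputable section

open scoped Classical

namespace Summit.BirchSwinnertonDyer.BirchSwinnertonDyer.Theorems.GenusSupplyNarrow.KFourPosCell

open WeierstrassCurve NumberField IsDedekindDomain Field Function
open Literature.NumberTheory.EllipticCurves Literature.NumberTheory.GaloisRepresentations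
open Literature.NumberTheory.GaloisCohomology
open Summit.BirchSwinnertonDyer.Rank1Residual.F1Sign2 (DescAdmissible NoRationalTwoTorsion selmerGroupRelaxedAtInfinityAtTwo)
open Summit.BirchSwinnertonDyer.BirchSwinnertonDyer.Theorems.GenusExact.PlusDescent

/-! ## §1 `d_K` is descent-admissible on the all-silent frame -/

section Admissible

variable (W : WeierstrassCurve ℚ) [W.IsElliptic] [W.IsGloballyMinimal] {K : Type} [Field K] [NumberField K]

/-- **`d_K` is DESCENT-ADMISSIBLE for `E` on the all-silent frame.**  `E/ℚ` globally minimal with `C(E)` odd; `K` imaginary quadratic with odd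
`d_K`, Heegner for `N_E`, `2` split in `K`; `Wd = Cd • E^{(d_K)}` elliptic with `ord₂ C(Wd) = 0`.  Then `F1Sign2.DescAdmissible E d_K`:
`d_K < 0`; squarefree (odd fundamental discriminant); `d_K ≡ 1 (mod 8)` (`2` split, Cox 5.16); every prime `q ∣ d_K` is odd, of good
reduction (Heegner: `q ∤ N`), with `a_q` odd (the `2`-division cubic has no root mod `q`: its factor `#roots_q + 1` of
`∏_{q ∣ d_K} (#roots_q + 1) = 2^{ord₂ C(Wd)} = 1` is `1`; `GenusKolyTwin.silent_iff_odd_frobeniusTrace`); `(d_K/ℓ) = 1` at every odd bad `ℓ`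
(Heegner).  [cite: Kramer1981, §2 Prop. 3, Prop. 6] [cite: Cox2013, §5.B Prop. 5.16 (p. 105)] [cite: Darmon2004, §3.9] -/
theorem descAdmissible_discr_of_allSilentTwin (hK : IsImaginaryQuadratic K) (hodd : Odd (discr K))
    (hH : SatisfiesHeegnerHypothesis (W.conductorNorm ℤ) K) (h2K : ((Ideal.span {(2 : ℤ)}).primesOver (𝓞 K)).ncard = 2)
    (hTam : Odd W.tamagawaProduct) {Wd : WeierstrassCurve ℚ} [Wd.IsElliptic] (Cd : VariableChange ℚ)
    (hCd : Cd • W.quadraticTwist (discr K : ℚ) = Wd) (hDEF : padicValNat 2 Wd.tamagawaProduct = 0) :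
    DescAdmissible W (discr K) := by
  have h2 : Module.finrank ℚ K = 2 := hK.1
  refine ⟨IsImaginaryQuadratic.discr_neg hK, squarefree_discr_of_odd h2 hodd, ?_, ?_, ?_⟩
  · exact HeegnerTraceSplit.discr_emod_eight_of_split_two h2 (by simpa only [Nat.cast_ofNat] using h2K)
  · intro q hq hqd
    haveI : Fact q.Prime := ⟨hq⟩
    have hq2 : q ≠ 2 := by
      rintro rfl
      obtain ⟨r, hr⟩ := hodd
      omega
    have hqΔ : ¬ (q : ℤ) ∣ minimalDiscriminantInt W := not_dvd_minimalDiscriminantInt_of_dvd_discr_of_heegner W K h2 hH hq hq2 hqd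
    refine ⟨fun _ ↦ W.hasGoodReductionAtPrime_of_not_dvd q hqΔ, (GenusKolyTwin.silent_iff_odd_frobeniusTrace W hq2 hqΔ).mp ?_⟩
    -- the factor at `q` of the Tamagawa identity is `1`: no root of the `2`-division cubic mod `q`
    have hprod := prod_ncard_roots_add_one_eq_two_pow_padicValNat_tamagawaProduct_twin W hK hodd hH hTam Cd hCd
    rw [hDEF, pow_zero] at hprod
    have hqS : q ∈ (discr K).natAbs.primeFactors :=
      Nat.mem_primeFactors.mpr ⟨hq, Int.natCast_dvd.mp (by simpa using hqd), Int.natAbs_ne_zero.mpr (NumberField.discr_ne_zero K)⟩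
    have h1 : ({x : ZMod q | 4 * x ^ 3 + ((integralModelInt W).b₂ : ZMod q) * x ^ 2 +
        2 * ((integralModelInt W).b₄ : ZMod q) * x + ((integralModelInt W).b₆ : ZMod q) = 0}.ncard + 1) ∣ 1 := by
      have h := Finset.dvd_prod_of_mem (fun q : ℕ ↦ ({x : ZMod q | 4 * x ^ 3 + ((integralModelInt W).b₂ : ZMod q) * x ^ 2 +
        2 * ((integralModelInt W).b₄ : ZMod q) * x + ((integralModelInt W).b₆ : ZMod q) = 0} : Set (ZMod q)).ncard + 1) hqS
      rw [hprod] at h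
      exact h
    have h0 : ({x : ZMod q | 4 * x ^ 3 + ((integralModelInt W).b₂ : ZMod q) * x ^ 2 +
        2 * ((integralModelInt W).b₄ : ZMod q) * x + ((integralModelInt W).b₆ : ZMod q) = 0} : Set (ZMod q)).ncard = 0 := by
      have := Nat.le_of_dvd one_pos h1
      omega
    have hempty := (Set.ncard_eq_zero (Set.toFinite _)).mp h0
    intro x hx
    have hmem : x ∈ ({x : ZMod q | 4 * x ^ 3 + ((integralModelInt W).b₂ : ZMod q) * x ^ 2 +
        2 * ((integralModelInt W).b₄ : ZMod q) * x + ((integralModelInt W).b₆ : ZMod q) = 0} : Set (ZMod q)) := hx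
    rw [hempty] at hmem
    exact hmem
  · intro ℓ hℓ hℓ2 hbad
    haveI : Fact ℓ.Prime := ⟨hℓ⟩
    exact Literature.SatisfiesHeegnerHypothesis.jacobiSym_discr_eq_one h2 hH hℓ
      ((W.dvd_conductorNorm_iff_not_hasGoodReductionAtPrime ℓ).mpr (hbad ⟨hℓ⟩)) hℓ2

end Admissible

/-! ## §2 Kramer's invariant part, counted: `#Sel₂(E_K/K)^{σ₀} = #Sel₂^{rel ∞}(E)` -/

section Invariants

variable (W : WeierstrassCurve ℚ) [W.IsElliptic] [W.IsGloballyMinimal] (K : Type) [Field K] [NumberField K]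

/-- **`#Sel₂(E_K/K)^{σ₀} = #Sel₂^{rel ∞}(E)`** for `E/ℚ` globally minimal with `E(ℚ)[2] = 0`, `K` quadratic with `d_K` descent-admissible
and `σ₀ ≠ 1`: `x ↦ res_K x` is a bijection from the ∞-relaxed `2`-Selmer group of `E` onto the `σ₀`-fixed `2`-Selmer classes of `E_K`
(`GenusKolyArch.mem_selmerGroup_and_conjAct_eq_iff_exists_mem_relaxed`; injective by `GenusExact.EigenClassesFinite.resTorsion_injective_of_noTorsion`,
`E(K)[2] = 0` from `E(ℚ)[2] = 0`).  [cite: Kramer1981, Thm. 1 (proof)] [cite: GrossLMS1991, §5 (5.1)] -/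
theorem natCard_fixedSelmer_eq_natCard_selmerGroupRelaxedAtInfinityAtTwo (hT : NoRationalTwoTorsion W)
    (hd : DescAdmissible W (discr K)) (h2 : Module.finrank ℚ K = 2) {σ₀ : K ≃ₐ[ℚ] K} (hσ₀ : σ₀ ≠ 1) :
    Nat.card {m : galH1Torsion (W.baseChange K) ((2 : ℕ) : ℤ) //
        m ∈ selmerGroup (W.baseChange K) ((2 : ℕ) : ℤ) ∧ conjAct W σ₀ ((2 : ℕ) : ℤ) m = m} =
      Nat.card (selmerGroupRelaxedAtInfinityAtTwo W) := by
  obtain ⟨θ, hθ, hc⟩ := Literature.NumberTheory.EllipticCurves.exists_sq_eq_discr_not_mem_range K h2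
  have hi : θ ^ 2 = ((discr K : ℤ) : K) := by rw [hc, map_intCast]
  have hL : ∀ P : (W.baseChange K).toAffine.Point, ((2 : ℕ) : ℤ) • P = 0 → P = 0 := fun P hP ↦
    Summit.BirchSwinnertonDyer.Rank1Residual.F1Sign2.EggDoubling.eq_zero_of_two_smul_eq_zero_baseChange W hT h2 P
      (by rwa [natCast_zsmul] at hP)
  have hinj := GenusExact.EigenClassesFinite.resTorsion_injective_of_noTorsion W K h2 hθ hc ((2 : ℕ) : ℤ) hL
  symm
  refine Nat.card_congr (Equiv.ofBijective
    (fun x : selmerGroupRelaxedAtInfinityAtTwo W ↦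
      (⟨resTorsion W K ((2 : ℕ) : ℤ) x.1,
        (GenusKolyArch.mem_selmerGroup_and_conjAct_eq_iff_exists_mem_relaxed W K hT hd h2 hi hσ₀ _).mpr ⟨x.1, x.2, rfl⟩⟩ :
        {m : galH1Torsion (W.baseChange K) ((2 : ℕ) : ℤ) //
          m ∈ selmerGroup (W.baseChange K) ((2 : ℕ) : ℤ) ∧ conjAct W σ₀ ((2 : ℕ) : ℤ) m = m}))
    ⟨fun x y hxy ↦ Subtype.ext (hinj (congrArg Subtype.val hxy)), fun m ↦ ?_⟩)
  obtain ⟨x, hx, hxm⟩ := (GenusKolyArch.mem_selmerGroup_and_conjAct_eq_iff_exists_mem_relaxed W K hT hd h2 hi hσ₀ m.1).mp m.2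
  exact ⟨⟨x, hx⟩, Subtype.ext hxm⟩

end Invariants

/-! ## §3 The K₄⁺ cell: `#Ш(E_K/K)[2] = 4`, `#Sel₂(E_K/K) = 8` -/

section Cell

variable (W : WeierstrassCurve ℚ) [W.IsElliptic] [W.IsGloballyMinimal] (K : Type) [Field K] [NumberField K]

/-- **THE 2-RANK OF `Ш(E/K)` ON THE K₄⁺ CELL IS 2: `#Ш(E_K/K)[2] = 4` and `#Sel₂(E_K/K) = 8`.**  HYPOTHESES: `E/ℚ` globally minimal, `Δ_E > 0`,
`ρ̄_{E,2}` onto, `C(E)` odd, the K₄⁺ clause `#Sel₂(E) = 4 ∧ ∃ c ∈ Sel₂(E), loc_∞ c ≠ 0` VERBATIM; `K` imaginary quadratic, `d_K` odd, Heegner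
for `N_E`, `2` split, `σ₀ ≠ 1`; `Wd = Cd • E^{(d_K)}` elliptic with `ord₂ C(Wd) = 0`; `rank E(K) = 1` (on the frame: `rank E(ℚ) = 0`, twin of
rank `1`); `Ш(E_K/K)[2^∞]` finite.  PROOF: §1 (`d_K` admissible) + §2 (invariants `= Sel₂^{rel ∞}(E)`) + the real switch
(`Sel₂^{rel ∞}(E) = Sel₂(E)`, a class at `∞`) give `#Sel₂(E_K)^{σ₀} = 4`; then the LEAD's `𝔽₂[G]`-count `#Sel₂(E_K) = 4k`, `k ∣ 4`, the descent
count `2·#E(K)[2]·#Ш[2] = #Sel₂` and the Cassels–Tate square force `k = 2`.  No print hypothesis.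
[cite: Kramer1981, Thm. 1] [cite: MazurRubin2010, Lemma 3.2] [cite: SilvermanAEC2009, Thm. X.4.2] [cite: Cassels1962ArithmeticIV] -/
theorem natCard_shaTorsionBy_two_baseChange_eq_four_of_kFourPos
    (hpos : 0 < W.Δ) (hs2 : W.HasSurjectiveModNGaloisRep 2) (hTam : Odd W.tamagawaProduct)
    (h4 : Nat.card (W.selmerGroup 2) = 4 ∧ ∃ c ∈ (W.kummerSelmerStructure ((2 : ℕ) : ℤ)).selmerGroup,
      galoisCohomology.localization (W.torsionGaloisModule ((2 : ℕ) : ℤ)) (Sum.inl Rat.infinitePlace) 1 c ≠ 0)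
    (hK : IsImaginaryQuadratic K) (hodd : Odd (discr K)) (hH : SatisfiesHeegnerHypothesis (W.conductorNorm ℤ) K)
    (h2K : ((Ideal.span {(2 : ℤ)}).primesOver (𝓞 K)).ncard = 2) {σ₀ : K ≃ₐ[ℚ] K} (hσ₀ : σ₀ ≠ 1)
    {Wd : WeierstrassCurve ℚ} [Wd.IsElliptic] (Cd : VariableChange ℚ) (hCd : Cd • W.quadraticTwist (discr K : ℚ) = Wd)
    (hDEF : padicValNat 2 Wd.tamagawaProduct = 0)
    (hrk : (W.baseChange K).mordellWeilRank = 1)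
    [Finite (AddCommGroup.primaryComponent (W.baseChange K).sha 2)] :
    Nat.card (AddSubgroup.torsionBy (W.baseChange K).sha ((2 : ℕ) : ℤ)) = 4 ∧
      Nat.card (selmerGroup (W.baseChange K) ((2 : ℕ) : ℤ)) = 8 := by
  haveI : Fact (Nat.Prime 2) := ⟨Nat.prime_two⟩
  haveI : (W.baseChange K).IsElliptic := inferInstanceAs ((W.map (algebraMap ℚ K)).IsElliptic)
  have h2 : Module.finrank ℚ K = 2 := hK.1
  haveI : IsGalois ℚ K := isGalois_of_finrank_eq_two K h2
  have hcard : Nat.card (K ≃ₐ[ℚ] K) = 2 := by rw [IsGalois.card_aut_eq_finrank, h2]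
  have hσσ : σ₀ * σ₀ = 1 := by
    rcases Literature.NumberTheory.QuadraticFields.eq_one_or_eq_of_card_eq_two hcard hσ₀ (σ₀ * σ₀) with h | h
    · exact h
    · exact absurd (mul_left_cancel (a := σ₀) (h.trans (mul_one σ₀).symm)) hσ₀
  -- `E(ℚ)[2] = 0`, `E(K)[2] = 0`
  have hsT : W.HasSurjectiveModNGaloisRep ((2 : ℤ) ^ 1) := by rw [pow_one]; exact hs2
  have hT : NoRationalTwoTorsion W := GenusKolyTwin.noRationalTwoTorsion_of_hasSurjectiveModNGaloisRep W hsT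
  have hL : ∀ P : (W.baseChange K).toAffine.Point, ((2 : ℕ) : ℤ) • P = 0 → P = 0 := fun P hP ↦
    Summit.BirchSwinnertonDyer.Rank1Residual.F1Sign2.EggDoubling.eq_zero_of_two_smul_eq_zero_baseChange W hT h2 P
      (by rwa [natCast_zsmul] at hP)
  -- §1 + §2 + the real switch: the invariants have order 4
  have hd := descAdmissible_discr_of_allSilentTwin W hK hodd hH h2K hTam Cd hCd hDEF
  obtain ⟨c, hc, hne⟩ := h4.2
  have hc' : c ∈ W.selmerGroup ((2 : ℕ) : ℤ) :=
    (SetLike.ext_iff.mp (W.selmerGroup_eq_selmerGroup_kummerSelmerStructure _) c).mpr hc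
  have hrel := GenusKolyArch.selmerGroupRelaxedAtInfinityAtTwo_eq_selmerGroup_of_exists_localization_ne_zero W hpos
    Rat.infinitePlace ⟨c, hc', hne⟩
  have h4' : Nat.card (W.selmerGroup ((2 : ℕ) : ℤ)) = 4 := h4.1
  have hfix := natCard_fixedSelmer_eq_natCard_selmerGroupRelaxedAtInfinityAtTwo W K hT hd h2 hσ₀
  rw [hrel, h4'] at hfix
  -- the `𝔽₂[G]`-count: `#Sel₂(E_K) = 4k`, `k ∣ 4`
  obtain ⟨k, hk, hkd⟩ := KFourCell.natCard_selmerGroup_baseChange_eq_mul W K (fun w ↦ hK.2.isComplex w) hσσ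
  rw [hfix] at hk hkd
  -- the descent count over `K`: `2 · #E(K)[2] · #Ш[2] = #Sel₂`
  have hpt : Nat.card (AddSubgroup.torsionBy (W.baseChange K).toAffine.Point ((2 : ℕ) : ℤ)) = 1 := by
    have hbot : AddSubgroup.torsionBy (W.baseChange K).toAffine.Point ((2 : ℕ) : ℤ) = ⊥ :=
      (AddSubgroup.eq_bot_iff_forall _).mpr fun P hP ↦ hL P (by
        rw [natCast_zsmul]; exact AddSubgroup.torsionBy.nsmul_iff.mp hP)
    rw [hbot, AddSubgroup.card_bot]
  have hcount := (W.baseChange K).pow_mordellWeilRank_mul_natCard_torsionBy_mul_natCard_shaTorsionBy_eq (n := 2) two_ne_zero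
  rw [hrk, pow_one, hpt, mul_one, hk] at hcount
  -- Cassels–Tate: `#Ш[2]` is a square
  have hsq : IsSquare (Nat.card (AddSubgroup.torsionBy (W.baseChange K).sha ((2 : ℕ) : ℤ))) := by
    have h := GenusExact.CasselsTateNumberField.isSquare_natCard_sha_torsionBy_pow (W.baseChange K) 2 1
    rwa [pow_one] at h
  -- `k ∈ {1, 2, 4}` and `2 · square = 4k`
  have hk4 : k ∣ 2 ^ 2 := by simpa using hkd
  obtain ⟨i, hi, rfl⟩ := (Nat.dvd_prime_pow Nat.prime_two).mp hk4
  obtain ⟨s, hs⟩ := hsq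
  interval_cases i
  · -- `k = 1`: `2 s² = 4`, impossible
    exfalso
    simp only [pow_zero, mul_one] at hcount
    have hs2 : s * s = 2 := by omega
    have hs' : s ≤ 2 := by nlinarith
    interval_cases s <;> omega
  · -- `k = 2`
    simp only [pow_one] at hcount
    constructor <;> omega
  · -- `k = 4`: `2 s² = 16`, impossible
    exfalso
    have hs2 : s * s = 8 := by simp only [show (2 : ℕ) ^ 2 = 4 from rfl] at hcount; omega
    have hs' : s ≤ 3 := by nlinarith
    interval_cases s <;> omega

end Cell

end Summit.BirchSwinnertonDyer.BirchSwinnertonDyer.Theorems.GenusSupplyNarrow.KFourPosCell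

end
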